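import Literature.AlgebraicGeometry.Frobenioids.DegreeModelFrobenioid
import Literature.AlgebraicGeometry.Frobenioids.EquivalenceThm34iiiOfPreSteps
import Literature.AlgebraicGeometry.Frobenioids.FSMFFType2024WalkingArrow
import Literature.AlgebraicGeometry.Frobenioids.FrTrFrobenioid
import HarnessLib

/-!
# Frobenioids I, Thm. 5.2 / Thm. 3.4: a Frobenioid over a base of FSMFF-type in the revised sense that is
# NOT of FSM-type — non-vacuity of the FSMFF-2024 generality of Theorem 3.4 at the level of Frobenioids

Mochizuki, *The geometry of Frobenioids I: the general theory*, Kyushu J. Math. **62** (2008), Thm. 5.2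
(i)–(iii), kurims pp. 100–101 (model Frobenioids) [cite: MochizukiFrdI2008, Thm. 5.2 (ii) p.101]; Thm. 3.4
(iii)–(v) pp. 62–63 [cite: MochizukiFrdI2008, Thm. 3.4 (iii) p.62]; condition (b) of "FSMFF-type" as revised in
the author's *Comments* (January 2024), item (28) [cite: MochizukiFrdIComments2024, (28) p.3].

PROOF-ONLY file (seat abc-iut-w4-d088; downstream of GAP-LEDGER row G-L1d8-1). The cell's kernel proofs of
[FrdI] Thm. 3.4 (ii)–(v) over bases of FSMFF-type in the revised sense (abc-iut-L1-t11's
`FrdI.thm34iii_ofFunctor_of_isOfFSMFFType2024`, this seat's `FrdI.thm34iv/v_ofFunctor_of_isOfFSMFFType2024`, `Thm34ivvOverFSMFF2024.lean`)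
strictly extend the FSM-type variants only if SOME Frobenioid lives over a base of the former kind that is not of
the latter kind. Abc-iut-w4-d093's kernel probe (staging, `ProbeThm34iiiFSMFF2024.lean` (P4)) exhibited such a
BASE, now in the tree as `FSMFFType2024WalkingArrow.lean` (`WalkingArrow.isOfFSMFFType2024`,
`WalkingArrow.not_isOfFSMType`): the walking arrow `Fin 2`. Here:
* §1 for ANY connected, totally epimorphic base `D`, the model Frobenioid (Thm. 5.2) of the constant divisor
  monoid `(ℕ, +)` (abc-iut-L1-d4's `DegreeModel.N`), the zero rational-function monoid `0_D` (`isMonoidOn_zeroMonoid`,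
  `FrTrFrobenioid.lean`; group-like via `DegreeModel.isGroupLike_of_subsingleton`) and any `Div_B` is a Frobenioid
  (abc-iut-L1-t2's Thm. 5.2 (ii)), of standard type as soon as `D` is of FSMFF-type (Thm. 5.2 (iii)), and not of
  group-like type;
* §2 the walking arrow `Fin 2` is connected and totally epimorphic;
* §3 hence: a Frobenioid of standard type over a base of FSMFF-type (revised) that is not of FSM-type EXISTS
  (`exists_frobenioid_over_fsmff2024_not_fsm`), and the typed Thm. 3.4 (iii)/(iv)/(v) conclusions hold for it
  through the FSMFF-2024 closers with ALL their antecedents discharged at `Ψ = 𝟭` (`thm34iii/iv/v_conclusion_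
  walkingArrow`) — the FSMFF-2024 theorems are inhabited beyond the reach of the FSM-type ones.
No new definition (all data are Mathlib / tree terms written out); no statement of the paper is strengthened.
-/

noncomputable section

namespace Literature.AlgebraicGeometry.Frobenioids

open CategoryTheory Opposite

namespace ConstNatModel

universe v u

/-! ### §1 The model Frobenioid of the constant monoid `(ℕ, +)` over any base -/

section AnyBase

variable (D : Type u) [Category.{v} D]

/-- The pull-back maps of the constant monoid `(ℕ, +)` on `D` are identities.
[cite: MochizukiFrdI2008, Def. 1.1 (ii) p.19] -/
@[simp] theorem pull_const {X Y : D} (f : Y ⟶ X)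
    (x : ((Functor.const Dᵒᵖ).obj (CommMonCat.of DegreeModel.N)).obj (op X)) :
    pull ((Functor.const Dᵒᵖ).obj (CommMonCat.of DegreeModel.N)) f x = x := rfl

/-- The constant monoid `(ℕ, +)` is a monoid on `D` (Def. 1.1 (ii): pull-backs characteristically injective,
FSM-morphisms pull back to bijections). [cite: MochizukiFrdI2008, Def. 1.1 (ii) p.19] -/
theorem isMonoidOn_const : IsMonoidOn ((Functor.const Dᵒᵖ).obj (CommMonCat.of DegreeModel.N)) where
  isCharInjective f := by
    refine ⟨fun x y h => h, fun x y hxy => ?_⟩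
    obtain ⟨a, rfl⟩ := Associates.mk_surjective x
    obtain ⟨b, rfl⟩ := Associates.mk_surjective y
    rw [associatesMap_mk, associatesMap_mk] at hxy
    exact hxy
  bijective_of_isFSM f _ := ⟨fun x y h => h, fun y => ⟨y, rfl⟩⟩

/-- The constant monoid `(ℕ, +)` is objectwise divisorial (abc-iut-L1-d4's `DegreeModel.isDivisorial_N`).
[cite: MochizukiFrdI2008, Def. 1.1 (i) p.19] -/
theorem objectwise_isDivisorial_const :
    Objectwise (fun M _ => IsDivisorial M) ((Functor.const Dᵒᵖ).obj (CommMonCat.of DegreeModel.N)) :=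
  fun _ => DegreeModel.isDivisorial_N

/-- The constant monoid `(ℕ, +)` is non-dilating. [cite: MochizukiFrdI2008, Def. 1.1 (ii) p.19] -/
theorem isNonDilatingOn_const : IsNonDilatingOn ((Functor.const Dᵒᵖ).obj (CommMonCat.of DegreeModel.N)) := by
  intro A α _
  refine MonoidHom.ext fun a => ?_
  obtain ⟨a, rfl⟩ := Associates.mk_surjective a
  rw [associatesMap_mk]
  rfl

/-- Over a non-empty base the constant monoid `(ℕ, +)` is not the zero monoid.
[cite: MochizukiFrdI2008, Thm. 5.2 (iii) p.101] -/
theorem not_isZeroMonoid_const [Nonempty D] :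
    ¬ ModelFrobenioid.IsZeroMonoid ((Functor.const Dᵒᵖ).obj (CommMonCat.of DegreeModel.N)) := fun h =>
  Nat.one_ne_zero (congrArg Multiplicative.toAdd
    (h (op (Classical.arbitrary D)) (Multiplicative.ofAdd (1 : ℕ))) : (1 : ℕ) = 0)

/-- The hypotheses of Thm. 5.2 for `(D, ℕ, 0_D)` over a connected, totally epimorphic base.
[cite: MochizukiFrdI2008, Thm. 5.2 p.100] -/
theorem hypotheses (hc : IsGraphConnected D) (he : IsTotallyEpimorphic D) :
    ModelFrobenioid.Hypotheses ((Functor.const Dᵒᵖ).obj (CommMonCat.of DegreeModel.N)) (zeroMonoid.{0} D) where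
  isMonoidOn := isMonoidOn_const D
  isDivisorial := objectwise_isDivisorial_const D
  isMonoidOn_rat := isMonoidOn_zeroMonoid
  isGroupLike_rat A :=
    haveI : Subsingleton ((zeroMonoid.{0} D).obj (op A)) := inferInstanceAs (Subsingleton PUnit)
    DegreeModel.isGroupLike_of_subsingleton _
  isGraphConnected := hc
  isTotallyEpimorphic := he

variable {D}
variable (DivB : zeroMonoid.{0} D ⟶ monoidGp ((Functor.const Dᵒᵖ).obj (CommMonCat.of DegreeModel.N)))

/-- **Thm. 5.2 (ii) for `(D, ℕ, 0_D, Div_B)`**: over a connected, totally epimorphic base the model Frobenioid is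
a Frobenioid (abc-iut-L1-t2's `ModelFrobenioid.isFrobenioid`). [cite: MochizukiFrdI2008, Thm. 5.2 (ii) p.101] -/
theorem isFrobenioid (hc : IsGraphConnected D) (he : IsTotallyEpimorphic D) :
    PreFrobenioid.IsFrobenioid (ModelFrobenioid.toElem _ _ DivB) :=
  ModelFrobenioid.isFrobenioid (isMonoidOn_const D) (objectwise_isDivisorial_const D) isMonoidOn_zeroMonoid
    (hypotheses D hc he).isGroupLike_rat hc he

/-- **Thm. 5.2 (iii) for `(D, ℕ, 0_D, Div_B)`**: over a connected, totally epimorphic base of FSMFF-type the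
model Frobenioid is of standard type (`Φ ≠ 0`, `Φ` non-dilating; abc-iut-L1-t2's `standardTypeIff_holds`).
[cite: MochizukiFrdI2008, Thm. 5.2 (iii) p.101] -/
theorem isOfStandardType [Nonempty D] (hc : IsGraphConnected D) (he : IsTotallyEpimorphic D)
    (hff : IsOfFSMFFType D) : (ModelFrobenioid.data _ _ DivB).IsOfStandardType :=
  (ModelFrobenioid.standardTypeIff_holds _ _ DivB (hypotheses D hc he)).mpr
    ⟨fun h0 => (not_isZeroMonoid_const D h0).elim, hff, isNonDilatingOn_const D⟩

/-- The model Frobenioid of `(D, ℕ, 0_D, Div_B)` over a non-empty base is NOT of group-like type (`Φ ≠ 0`).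
[cite: MochizukiFrdI2008, Thm. 5.2 (iii) p.101] -/
theorem not_isOfGroupLikeType [Nonempty D] : ¬ (ModelFrobenioid.data _ _ DivB).IsOfGroupLikeType := fun h =>
  not_isZeroMonoid_const D ((ModelFrobenioid.data_isOfGroupLikeType_iff _ _ DivB).mp h)

end AnyBase

/-! ### §2 The walking arrow `Fin 2`: connected and totally epimorphic (FSMFF-type (revised), not FSM-type:
abc-iut-w4-d093's `FSMFFType2024WalkingArrow.lean`) -/

section WalkingArrow

/-- The walking arrow is connected. [cite: MochizukiFrdI2008, §0 p.16] -/
theorem isGraphConnected_fin2 : IsGraphConnected (Fin 2) :=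
  ⟨⟨0⟩, fun X Y => by
    rcases le_total X Y with h | h
    · exact Zigzag.of_hom (homOfLE h)
    · exact Zigzag.of_inv (homOfLE h)⟩

/-- The walking arrow is totally epimorphic (a thin category). [cite: MochizukiFrdI2008, §0 p.15] -/
theorem isTotallyEpimorphic_fin2 : IsTotallyEpimorphic (Fin 2) :=
  ⟨fun _ => ⟨fun _ _ _ => Subsingleton.elim _ _⟩⟩

end WalkingArrow

/-! ### §3 The Frobenioid over the walking arrow; the FSMFF-2024 closers of Thm. 3.4 are inhabited there -/

section Witness

variable (DivB : zeroMonoid.{0} (Fin 2) ⟶ monoidGp ((Functor.const (Fin 2)ᵒᵖ).obj (CommMonCat.of DegreeModel.N)))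

/-- **The model Frobenioid of `(Fin 2, ℕ, 0, Div_B)` is a Frobenioid** — over a base of FSMFF-type (revised)
that is not of FSM-type. [cite: MochizukiFrdI2008, Thm. 5.2 (ii) p.101] -/
theorem isFrobenioid_walkingArrow : PreFrobenioid.IsFrobenioid (ModelFrobenioid.toElem _ _ DivB) :=
  isFrobenioid DivB isGraphConnected_fin2 isTotallyEpimorphic_fin2

/-- … and of standard type (Thm. 5.2 (iii); `Fin 2` is of FSMFF-type (revised), hence of FSMFF-type).
[cite: MochizukiFrdI2008, Thm. 5.2 (iii) p.101] -/
theorem isOfStandardType_walkingArrow : (ModelFrobenioid.data _ _ DivB).IsOfStandardType :=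
  isOfStandardType DivB isGraphConnected_fin2 isTotallyEpimorphic_fin2 WalkingArrow.isOfFSMFFType

/-- Hypothesis (b) `HypB` holds vacuously for it (not of group-like type). [cite: MochizukiFrdI2008, Thm. 3.4 (iii) p.62] -/
theorem hypB_walkingArrow (Ψ : ModelFrobenioid _ _ DivB ≌ ModelFrobenioid _ _ DivB) :
    (ModelFrobenioid.data _ _ DivB).HypB (ModelFrobenioid.data _ _ DivB) Ψ :=
  fun hg _ => (not_isOfGroupLikeType DivB hg).elim

/-- **Non-vacuity of [FrdI] Thm. 3.4 (iii) over FSMFF-2024 bases at Frobenioid level**: for the Frobenioid over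
the walking arrow (NOT of FSM-type) and any self-equivalence `Ψ`, the CONCLUSION of the typed `Thm34iii` — the
seven preservation clauses and the automorphism `Ψ^{ℕ≥1}` — holds, all antecedents being discharged
(abc-iut-L1-t11's `FrdI.thm34iii_ofFunctor_of_isOfFSMFFType2024`). [cite: MochizukiFrdI2008, Thm. 3.4 (iii) p.62]
[cite: MochizukiFrdIComments2024, (28) p.3] -/
theorem thm34iii_conclusion_walkingArrow (Ψ : ModelFrobenioid _ _ DivB ≌ ModelFrobenioid _ _ DivB) :
    (PreFrobenioidData.PreservesMor Ψ.functor (ModelFrobenioid.data _ _ DivB).IsFrobeniusType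
        (ModelFrobenioid.data _ _ DivB).IsFrobeniusType ∧
      PreFrobenioidData.PreservesMor Ψ.functor (ModelFrobenioid.data _ _ DivB).IsLinear
        (ModelFrobenioid.data _ _ DivB).IsLinear ∧
      PreFrobenioidData.PreservesMor Ψ.functor (ModelFrobenioid.data _ _ DivB).IsBaseIso
        (ModelFrobenioid.data _ _ DivB).IsBaseIso ∧
      PreFrobenioidData.PreservesMor Ψ.functor (ModelFrobenioid.data _ _ DivB).IsCoAngular
        (ModelFrobenioid.data _ _ DivB).IsCoAngular ∧
      PreFrobenioidData.PreservesMor Ψ.functor (ModelFrobenioid.data _ _ DivB).IsPullbackMorphism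
        (ModelFrobenioid.data _ _ DivB).IsPullbackMorphism ∧
      PreFrobenioidData.PreservesMor Ψ.functor (ModelFrobenioid.data _ _ DivB).IsIsometry
        (ModelFrobenioid.data _ _ DivB).IsIsometry ∧
      PreFrobenioidData.PreservesMor Ψ.functor (ModelFrobenioid.data _ _ DivB).IsLBInvertible
        (ModelFrobenioid.data _ _ DivB).IsLBInvertible) ∧
    ∃ ΨN : ℕ+ ≃* ℕ+, (∀ ⦃A B : ModelFrobenioid _ _ DivB⦄ (φ : A ⟶ B),
        (ModelFrobenioid.data _ _ DivB).degFr (Ψ.functor.map φ) = ΨN ((ModelFrobenioid.data _ _ DivB).degFr φ)) ∧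
      ((∃ A, ¬ (ModelFrobenioid.data _ _ DivB).IsGroupLikeObj A) →
        (∃ A, ¬ (ModelFrobenioid.data _ _ DivB).IsGroupLikeObj A) → ΨN = MulEquiv.refl ℕ+) :=
  FrdI.thm34iii_ofFunctor_of_isOfFSMFFType2024 (isFrobenioid_walkingArrow DivB) (isFrobenioid_walkingArrow DivB)
    WalkingArrow.isOfFSMFFType2024 WalkingArrow.isOfFSMFFType2024 Ψ (isOfStandardType_walkingArrow DivB)
    (isOfStandardType_walkingArrow DivB) (hypB_walkingArrow DivB Ψ)

/-- **A Frobenioid of standard type over a base of FSMFF-type (revised) that is NOT of FSM-type EXISTS** —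
so the cell's FSMFF-2024 closers of [FrdI] Thm. 3.4 (iii)–(v) strictly extend the FSM-type ones at the level
of Frobenioids, not only of base categories. [cite: MochizukiFrdI2008, Thm. 5.2 (ii) p.101]
[cite: MochizukiFrdIComments2024, (28) p.3] -/
theorem exists_frobenioid_over_fsmff2024_not_fsm :
    ∃ (D : Type) (_ : Category.{0} D) (Φ : Dᵒᵖ ⥤ CommMonCat.{0}) (C : Type) (_ : Category.{0} C)
      (F : C ⥤ ElemFrobenioid Φ), PreFrobenioid.IsFrobenioid F ∧
        (PreFrobenioidData.ofFunctor Φ F).IsOfStandardType ∧ IsOfFSMFFType2024 D ∧ ¬ IsOfFSMType D := by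
  let DivB : zeroMonoid.{0} (Fin 2) ⟶ monoidGp ((Functor.const (Fin 2)ᵒᵖ).obj (CommMonCat.of DegreeModel.N)) :=
    { app := fun _ => CommMonCat.ofHom 1
      naturality := fun X Y f => by
        apply CommMonCat.hom_ext
        apply MonoidHom.ext
        intro x
        change (1 : (zeroMonoid.{0} (Fin 2)).obj Y →* _) ((zeroMonoid.{0} (Fin 2)).map f x) =
          ((monoidGp ((Functor.const (Fin 2)ᵒᵖ).obj (CommMonCat.of DegreeModel.N))).map f).hom
            ((1 : (zeroMonoid.{0} (Fin 2)).obj X →* _) x)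
        rw [MonoidHom.one_apply, MonoidHom.one_apply, map_one] }
  exact ⟨Fin 2, inferInstance, _, ModelFrobenioid _ _ DivB, inferInstance, ModelFrobenioid.toElem _ _ DivB,
    isFrobenioid_walkingArrow DivB, isOfStandardType_walkingArrow DivB, WalkingArrow.isOfFSMFFType2024,
    WalkingArrow.not_isOfFSMType⟩

end Witness

end ConstNatModel

end Literature.AlgebraicGeometry.Frobenioids
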